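import Summits.CriticalPhenomena.CardyFormulaZ2.Theses.CardyBoundaryCoulombGas

/-!
# Sketch (crux-ideate, ideator 3): first lemmas for the three idea cards on
`HalfPlaneOneArmThird` (stmt-CriticalPhenomena-5662)

Conventions. `μ` = bond percolation on `ℤ²` at `p = 1/2`. The Razumov–Stroganov / qKZ transfer
matrix of the Temperley–Lieb(`β = 1`) loop model describes bond percolation on `ℤ²` in the DIAGONAL
orientation (bonds at ±45° to the transfer direction; numerically verified against
Ikhlef–Ponsaing's closed forms for `L = 3, 5`, see NOTES.md / kit j008666). We therefore phrase the
strip / cylinder carriers with walls along the anti-diagonal lines `v 0 + v 1 = const` of `ℤ²`, and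
add an orientation-transfer statement to reach the crux (axis half-plane).
-/

noncomputable section

namespace Summit.CriticalPhenomena.CardyFormulaZ2.Cruxes.HalfPlaneOneArmThird.IdeatorThree

open Literature.Probability.Percolation Literature.Probability.LatticeModels
open Filter MeasureTheory
open scoped BigOperators

/-- Bond percolation on `ℤ²` at `p = 1/2`. -/
abbrev μ : Measure (BondConfig (Site 2)) := bondPercolation (zdGraph 2) half

/-! ## Card 1 — Ikhlef–Ponsaing wall passage (diagonal wired/free strip) -/

/-- Ikhlef–Ponsaing's strip of medial width `L` = the diagonal strip `0 ≤ v₀+v₁ ≤ L` of `ℤ²`;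
the line `v₀+v₁ = 0` is the WIRED wall (we ask for a connection to any of its sites), the line
`v₀+v₁ = L` carries the last row of sites (FREE wall). -/
def diagStrip (L : ℕ) : Set (Site 2) := {v | 0 ≤ v 0 + v 1 ∧ v 0 + v 1 ≤ (L : ℤ)}

/-- `P_b(L)` (IP 2012 Def 4.1 / Prop 4.7): the site `(L-1, 0)`, one unit inside the free wall, is
joined inside the strip to the wired wall. Numerically: `P_b(3) = 3/4`, `P_b(5) = 78/121`. -/
def wallPassageProb (L : ℕ) : ℝ :=
  μ.real {ω | ∃ y : Site 2, y 0 + y 1 = 0 ∧ ω ∈ openConnIn (diagStrip L) ![(L : ℤ) - 1, 0] y}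

/-- `P̂_b(L)` (IP 2012 Def 4.2 / Prop 4.8): the site `(L, 0)` ON the free wall line is joined inside
the strip to the wired wall. Numerically: `P̂_b(3) = 147/256`, `P̂_b(5) = 507/1024`. -/
def wallTouchProb (L : ℕ) : ℝ :=
  μ.real {ω | ∃ y : Site 2, y 0 + y 1 = 0 ∧ ω ∈ openConnIn (diagStrip L) ![(L : ℤ), 0] y}

/-- `A_V(2m+1)`, the number of vertically symmetric ASMs (IP 2012 Prop 4.7). -/
def AV (m : ℕ) : ℚ :=
  ∏ i ∈ Finset.range m,
    (((3 * i + 2 : ℕ) : ℚ) * ((6 * i + 3).factorial : ℚ) * ((2 * i + 1).factorial : ℚ)) /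
      (((4 * i + 2).factorial : ℚ) * ((4 * i + 3).factorial : ℚ))

/-- `N_8(2m)`, cyclically symmetric self-complementary plane partitions (IP 2012 Prop 4.7). -/
def N8 (m : ℕ) : ℚ :=
  ∏ i ∈ Finset.range m,
    (((3 * i + 1 : ℕ) : ℚ) * ((6 * i).factorial : ℚ) * ((2 * i).factorial : ℚ)) /
      (((4 * i).factorial : ℚ) * ((4 * i + 1).factorial : ℚ))

/-- C⁺ of card 1 (the exactly solvable transfer of the crux): Ikhlef–Ponsaing's closed form,
`P_b(2m+1) = A_V(2m+1) A_V(2m+3) / N_8(2m+2)²`. -/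
def IPClosedForm : Prop :=
  ∀ m : ℕ, 1 ≤ m → wallPassageProb (2 * m + 1) = ((AV m * AV (m + 1) / (N8 (m + 1)) ^ 2 : ℚ) : ℝ)

/-- IP 2012 Prop 4.9 constant `C = 9·2^{-5/3} Γ(1/3)Γ(5/6)/(Γ(1/6)Γ(2/3)) ≈ 1.137`. -/
def ipConstant : ℝ :=
  9 * (2 : ℝ) ^ (-(5 / 3 : ℝ)) * Real.Gamma (1 / 3) * Real.Gamma (5 / 6) /
    (Real.Gamma (1 / 6) * Real.Gamma (2 / 3))

/-- The Stirling/Barnes step: `(2m+1)^{1/3} P_b(2m+1) → C`. -/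
def IPAsymptotics : Prop :=
  Tendsto (fun m : ℕ ↦ (((2 * m + 1 : ℕ) : ℝ)) ^ (1 / 3 : ℝ) * wallPassageProb (2 * m + 1))
    atTop (nhds ipConstant)

/-- One-arm probability to sup-distance `n` in the DIAGONAL half-plane `v₀+v₁ ≤ 1` (free boundary
line `v₀+v₁ = 1`, the site `0` one unit inside — exactly the position of IP's first site). -/
def diagArmBelow (n : ℕ) : ℝ :=
  μ.real {ω | ∃ y : Site 2, (y 0 = (n : ℤ) ∨ y 0 = -(n : ℤ) ∨ y 1 = (n : ℤ) ∨ y 1 = -(n : ℤ)) ∧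
    ω ∈ openConnIn {v : Site 2 | v 0 + v 1 ≤ 1 ∧ -(n : ℤ) ≤ v 0 ∧ v 0 ≤ n ∧ -(n : ℤ) ≤ v 1 ∧ v 1 ≤ n}
      0 y}

/-- FIRST LEMMA of card 1 (exact-inclusion half of the wall dictionary, provable now): a path from
`(L-1,0)` to the wired wall inside the strip leaves the sup-box of radius `⌊(L-1)/2⌋`, and until then
it runs in the half-plane below the free line. -/
theorem wallPassageProb_le_diagArmBelow (L : ℕ) (hL : 3 ≤ L) :
    wallPassageProb L ≤ diagArmBelow ((L - 1) / 2) := by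
  sorry

/-- RSW half of the wall dictionary (gluing to the wired wall at bounded cost). -/
def WallDictionaryLower : Prop :=
  ∃ c : ℝ, 0 < c ∧ ∀ L : ℕ, 3 ≤ L → c * diagArmBelow L ≤ wallPassageProb L

/-- The diagonal half-plane one-arm exponent (the form every RS/qKZ/Bethe line actually proves). -/
def DiagHalfPlaneOneArmThird : Prop :=
  Tendsto (fun n : ℕ ↦ Real.log (diagArmBelow n) / Real.log n) atTop (nhds (-(1 / 3 : ℝ)))

/-- Orientation transfer (support, shared by all three cards): DKKMO 2020 Cor. 1.3 (rotation
invariance of quad crossings for `q = 1`) + RSW quasi-multiplicativity on blocks of ratio `λ → ∞`. -/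
def OrientationTransfer : Prop :=
  DiagHalfPlaneOneArmThird →
    Summit.CriticalPhenomena.CardyFormulaZ2.Theses.CardyBoundaryCoulombGas.HalfPlaneOneArmThird

/-- Card 1 as a line (shape only; no proof claimed here). -/
def CardOneLine : Prop :=
  IPAsymptotics → WallDictionaryLower → OrientationTransfer →
    Summit.CriticalPhenomena.CardyFormulaZ2.Theses.CardyBoundaryCoulombGas.HalfPlaneOneArmThird

/-! ## Card 2 — boundary-field response (Hellmann–Feynman at the quantum-group point) -/

/-- FIRST LEMMA of card 2 (generic, provable now): Hellmann–Feynman for a biorthogonal eigenpair of a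
one-parameter matrix family, componentwise derivatives (no operator norm needed). With
`A = ` Sklyanin's double-row transfer matrix / open XXZ Hamiltonian at `Δ = -1/2` as a function of the
diagonal boundary field `h₁`, `lam = E₀`, this turns IP 2012 Prop 5.5 (`P_b = Re⟨σ₁ᶻ⟩`) into
`P_b(L) = -Re ∂E₀/∂h₁` at the `U_q(sl₂)` point. -/
theorem hellmannFeynman {ι : Type*} [Fintype ι] [DecidableEq ι]
    (A : ℝ → Matrix ι ι ℂ) (A' : Matrix ι ι ℂ) (u v : ℝ → ι → ℂ) (u' v' : ι → ℂ)
    (lam : ℝ → ℂ) (lam' : ℂ) (t₀ : ℝ)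
    (hA : ∀ i j, HasDerivAt (fun t ↦ A t i j) (A' i j) t₀)
    (hu : ∀ i, HasDerivAt (fun t ↦ u t i) (u' i) t₀)
    (hv : ∀ i, HasDerivAt (fun t ↦ v t i) (v' i) t₀)
    (hlam : HasDerivAt lam lam' t₀)
    (hright : ∀ t, (A t).mulVec (v t) = lam t • v t)
    (hleft : ∀ t, Matrix.vecMul (u t) (A t) = lam t • u t)
    (hnd : ∑ i, u t₀ i * v t₀ i ≠ 0) :
    lam' = (∑ i, u t₀ i * (A'.mulVec (v t₀)) i) / (∑ i, u t₀ i * v t₀ i) := by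
  sorry

/-- C⁺ of card 2, percolation-side: the wall passage probability has a pure power decay with exponent
`1/3` (no closed form needed, only the exponent of the energy response). -/
def WallPassageExponent : Prop :=
  Tendsto (fun L : ℕ ↦ Real.log (wallPassageProb (2 * L + 1)) / Real.log (2 * L + 1)) atTop
    (nhds (-(1 / 3 : ℝ)))

/-! ## Card 3 — comb-glued cylinder end: the boundary two-point function -/

/-- The boundary two-point function of the DIAGONAL half-plane `0 ≤ v₀ + v₁` (free boundary row =
the line itself): `τ⁺(x) = μ[(0,0) ↔ (x,-x) inside the half-plane]`; the `n → ∞` limit of the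
exactly-RS boundary two-point function at the end of the half-infinite cylinder of perimeter `n`. -/
def tauPlus (x : ℕ) : ℝ :=
  μ.real (openConnIn {v : Site 2 | 0 ≤ v 0 + v 1} 0 ![(x : ℤ), -(x : ℤ)])

/-- One-arm probability to sup-distance `n` in the diagonal half-plane `0 ≤ v₀+v₁`, site ON the
boundary line. -/
def diagArmAbove (n : ℕ) : ℝ :=
  μ.real {ω | ∃ y : Site 2, (y 0 = (n : ℤ) ∨ y 0 = -(n : ℤ) ∨ y 1 = (n : ℤ) ∨ y 1 = -(n : ℤ)) ∧
    ω ∈ openConnIn {v : Site 2 | 0 ≤ v 0 + v 1 ∧ -(n : ℤ) ≤ v 0 ∧ v 0 ≤ n ∧ -(n : ℤ) ≤ v 1 ∧ v 1 ≤ n}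
      0 y}

/-- FIRST LEMMA of card 3 (provable now from independence of disjoint edge sets + translation
invariance along the boundary line): the two-point function is at most the square of the one-arm
probability at the matched scale. -/
theorem tauPlus_le_sq (x : ℕ) (hx : 3 ≤ x) : tauPlus x ≤ diagArmAbove ((x - 1) / 2) ^ 2 := by
  sorry

/-- RSW half of the two-point dictionary. -/
def TwoPointDictionaryLower : Prop :=
  ∃ c : ℝ, 0 < c ∧ ∀ x : ℕ, 3 ≤ x → c * diagArmAbove x ^ 2 ≤ tauPlus x

/-- C⁺ of card 3: boundary two-point exponent `2/3` (diagonal boundary). -/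
def BoundaryTwoPointTwoThirds : Prop :=
  Tendsto (fun x : ℕ ↦ Real.log (tauPlus x) / Real.log x) atTop (nhds (-(2 / 3 : ℝ)))

end Summit.CriticalPhenomena.CardyFormulaZ2.Cruxes.HalfPlaneOneArmThird.IdeatorThree

end
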